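import Literature.NumberTheory.LFunctions.WeilLogLatticeComb
import HarnessLib

/-!
# The zero killer: polynomial multipliers of the transform are differential operators
(TRACK «HANDOFF», prove-1 ATTEMPT-5 §2 (iii)–(iv))

For a test function `g` and a polynomial `p`, the function `p(-D) g := ∑ₖ p_k (-1)^k g^{(k)}` is again
a test function, supported inside `tsupport g`, and its transform is `p(s - 1/2) · ĝ(s)`
(`weilMellin_iterate_deriv`: `(g^{(k)})^(s) = (-(s-1/2))^k ĝ(s)`). Consequently, for every finite
set `Z ⊂ ℂ` there is a test function `F` with the SAME support as `g` whose transform is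
`∏_{z ∈ Z} (s - 1/2 - z) · ĝ(s)` — it vanishes at the prescribed points `1/2 + z` («kills» them)
without enlarging the support. This is the device `F = P(D) S(D) F₀` of the windowed Weil converse
(ATTEMPT-5, Theorem A): the zeros of `ζ` up to height `T*` are killed at no cost in support.
-/

noncomputable section

set_option linter.dupNamespace false

open Complex Polynomial Set

namespace Summit.RiemannHypothesis.RiemannHypothesis.Theorems.WeilConverseWindow

open Literature.NumberTheory.LFunctions

variable {g : ℝ → ℂ}

/-! The differential operator `p(-D)` applied to `g` is written out in full below as
`fun t ↦ ∑ k ∈ Finset.range (p.natDegree + 1), p.coeff k * (-1) ^ k * (deriv^[k] g) t`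
(no auxiliary definition, so that this file is proof-only). -/

/-- `p(-D) g = ∑ₖ p_k (-1)^k g^{(k)}` is a test function if `g` is. [folklore] -/
theorem isWeilTest_polyDeriv (p : ℂ[X]) (hg : IsWeilTest g) :
    IsWeilTest fun t ↦ ∑ k ∈ Finset.range (p.natDegree + 1), p.coeff k * (-1) ^ k * (deriv^[k] g) t :=
  isWeilTest_finset_sum _ fun k _ ↦ (isWeilTest_iterate_deriv hg k).const_mul _

/-- **Transform of `p(-D) g`**: `(∑ₖ p_k (-1)^k g^{(k)})^(s) = p(s - 1/2) · ĝ(s)`. [folklore] -/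
theorem weilMellin_polyDeriv (p : ℂ[X]) (hg : IsWeilTest g) (s : ℂ) :
    weilMellin (fun t ↦ ∑ k ∈ Finset.range (p.natDegree + 1), p.coeff k * (-1) ^ k * (deriv^[k] g) t) s =
      p.eval (s - 1 / 2) * weilMellin g s := by
  rw [weilMellin_finset_sum _ fun k _ ↦ (isWeilTest_iterate_deriv hg k).const_mul _]
  simp_rw [weilMellin_const_mul, weilMellin_iterate_deriv hg, Polynomial.eval_eq_sum_range,
    Finset.sum_mul]
  refine Finset.sum_congr rfl fun k _ ↦ ?_
  have h : (-1 : ℂ) ^ k * (-(s - 1 / 2)) ^ k = (s - 1 / 2) ^ k := by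
    rw [← mul_pow, neg_one_mul, neg_neg]
  calc p.coeff k * (-1) ^ k * ((-(s - 1 / 2)) ^ k * weilMellin g s)
        = p.coeff k * ((-1 : ℂ) ^ k * (-(s - 1 / 2)) ^ k) * weilMellin g s := by ring
    _ = p.coeff k * (s - 1 / 2) ^ k * weilMellin g s := by rw [h]

/-- `p(-D) g` is supported inside `tsupport g`. [folklore] -/
theorem tsupport_polyDeriv_subset (p : ℂ[X]) (g : ℝ → ℂ) :
    tsupport (fun t ↦ ∑ k ∈ Finset.range (p.natDegree + 1), p.coeff k * (-1) ^ k * (deriv^[k] g) t) ⊆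
      tsupport g := by
  -- iterated derivatives do not enlarge the topological support (cf. the identical lemma
  -- `Summit.Ventures.WeilGRH.tsupport_iterate_deriv_subset`, not importable here)
  have hiter : ∀ k : ℕ, tsupport (deriv^[k] g) ⊆ tsupport g := by
    intro k
    induction k with
    | zero => simp
    | succ k ih =>
      rw [Function.iterate_succ_apply']
      exact (tsupport_deriv_subset).trans ih
  have hK : IsClosed (tsupport g) := isClosed_tsupport g
  refine closure_minimal ?_ hK
  intro t ht
  by_contra hnot
  apply ht
  refine Finset.sum_eq_zero fun k _ ↦ ?_
  have hk : t ∉ tsupport (deriv^[k] g) := fun h ↦ hnot (hiter k h)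
  rw [image_eq_zero_of_notMem_tsupport hk, mul_zero]

/-- **ZERO KILLER.** For a test function `g` and a finite set `Z ⊂ ℂ` there is a test function `F`,
supported inside `tsupport g`, with `F̂(s) = (∏_{z∈Z} (s - 1/2 - z)) · ĝ(s)` for all `s`; in
particular `F̂(1/2 + z) = 0` for every `z ∈ Z`. (ATTEMPT-5 §2: killing the zeros of `ζ` below
height `T*` costs no support.) [folklore] -/
theorem exists_isWeilTest_weilMellin_eq_prod_mul (hg : IsWeilTest g) (Z : Finset ℂ) :
    ∃ F : ℝ → ℂ, IsWeilTest F ∧ tsupport F ⊆ tsupport g ∧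
      ∀ s : ℂ, weilMellin F s = (∏ z ∈ Z, (s - 1 / 2 - z)) * weilMellin g s := by
  refine ⟨_, isWeilTest_polyDeriv (∏ z ∈ Z, (X - C z)) hg,
    tsupport_polyDeriv_subset (∏ z ∈ Z, (X - C z)) g, fun s ↦ ?_⟩
  rw [weilMellin_polyDeriv _ hg, Polynomial.eval_prod]
  simp

/-- The killed transform vanishes at the prescribed points. [folklore] -/
theorem exists_isWeilTest_weilMellin_eq_zero_on (hg : IsWeilTest g) (Z : Finset ℂ) :
    ∃ F : ℝ → ℂ, IsWeilTest F ∧ tsupport F ⊆ tsupport g ∧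
      (∀ s : ℂ, weilMellin F s = (∏ z ∈ Z, (s - 1 / 2 - z)) * weilMellin g s) ∧
      ∀ z ∈ Z, weilMellin F (1 / 2 + z) = 0 := by
  obtain ⟨F, hF, hsupp, hmel⟩ := exists_isWeilTest_weilMellin_eq_prod_mul hg Z
  refine ⟨F, hF, hsupp, hmel, fun z hz ↦ ?_⟩
  rw [hmel, Finset.prod_eq_zero hz (by ring), zero_mul]

end Summit.RiemannHypothesis.RiemannHypothesis.Theorems.WeilConverseWindow

end
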